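import Literature.Probability.LatticeModels.KCSignConfigExists
import Literature.Probability.RandomPlanarGeometry.JordanDomainInterior
import HarnessLib

/-!
# The sign condition of Kadanoff–Ceva limits (Chelkak–Smirnov)

Topic `Literature/Probability/LatticeModels`. The conclusion of the lattice sign-condition argument
(`KCSignConfig.false_of_limit` + `exists_config`): the negativity of a continuum limit near a
boundary point is contradictory.

* `false_of_neg_near_frontier`: for an open path-connected `Ω` with an exterior point near the
  boundary point `ζ`, lattice functions `u_n` (sub-harmonic for the boundary-modified Laplacian
  off a far exceptional region `W`, non-negative at frozen-corner plaquettes, bounded by `M_u N_n`,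
  locally uniformly close to `N_n · hlim`) with bulk coverage and visibility of the boundary
  cannot have a limit `hlim < 0` on `Ω ∩ ball ζ ρ`.
* `exists_exceptional_region`: the exceptional region about two interior points.
* `JordanDomain.false_of_neg_near_frontier`: the same for a Jordan domain (exterior points from
  the Jordan curve theorem), with the exceptional set two balls about interior points.

This is hypothesis (2) ("`H ≥ 0` on the boundary arc" in the weak form "`h ≤ 0` fails nowhere near
the arc") of the boundary value problem identifying the scaling limits of spinor observables.
[cite: ChelkakSmirnov2012Ising, Thm. 6.1 and Remark 6.3; ChelkakHonglerIzyurovAnnals2015, Prop. 3.9 (2) / proof of Thm. 3.13]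

All proved; no named fact.
-/

noncomputable section

open Set Metric Filter Topology

namespace Literature.Probability.LatticeModels

open Site

namespace KCSignConfig

variable {Ω G Bad : Set ℂ} (cfg : KCSignConfig Ω G Bad)

/-- `Kmid μ` is compact. [folklore] -/
theorem isCompact_Kmid (μ : ℝ) : IsCompact (cfg.Kmid μ) :=
  (isCompact_iUnion fun _ => isCompact_l1ball _ _).union
    (isCompact_of_isClosed_isBounded isClosed_cthickening cfg.isCompact_Mset.isBounded.cthickening)

/-- `Kflat` is compact. [folklore] -/
theorem isCompact_Kflat : IsCompact cfg.Kflat := by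
  refine isCompact_of_isClosed_isBounded isClosed_cthickening (Bornology.IsBounded.cthickening ?_)
  rw [segment_eq_image']
  exact (isCompact_Icc.image (by fun_prop)).isBounded

end KCSignConfig

/-! ### Eventual signs from local uniform convergence -/

/-- On a compact set where the limit is negative, lattice functions locally uniformly close to
`N · hlim` are eventually non-positive, indeed eventually `≤ (max hlim / 2) · N`. [folklore] -/
theorem eventually_le_of_conv {S K : Set ℂ} (hK : IsCompact K) (hKS : K ⊆ S) {hlim : ℂ → ℝ} (hcont : ContinuousOn hlim S)
    (hneg : ∀ z ∈ S, hlim z < 0) (δ : ℕ → ℝ) (u : ℕ → Site 2 → ℝ) (N : ℕ → ℝ) (hN : ∀ n, 0 < N n)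
    (hconv : ∀ ε, 0 < ε → ∀ᶠ n in atTop, ∀ f : Site 2, ((δ n : ℝ) : ℂ) * plaqCentre f ∈ K → |u n f / N n - hlim (((δ n : ℝ) : ℂ) * plaqCentre f)| ≤ ε) :
    ∃ η : ℝ, 0 < η ∧ ∀ᶠ n in atTop, ∀ f : Site 2, ((δ n : ℝ) : ℂ) * plaqCentre f ∈ K → u n f ≤ -(η * N n) := by
  rcases K.eq_empty_or_nonempty with rfl | hne
  · exact ⟨1, one_pos, Eventually.of_forall fun n f hf => absurd hf (Set.notMem_empty _)⟩
  obtain ⟨z₀, hz₀, hmax⟩ := hK.exists_isMaxOn hne (hcont.mono hKS)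
  set M := hlim z₀
  have hM : M < 0 := hneg z₀ (hKS hz₀)
  refine ⟨-M / 2, by linarith, (hconv (-M / 2) (by linarith)).mono fun n hn f hf => ?_⟩
  have h1 := hn f hf
  have h2 : hlim (((δ n : ℝ) : ℂ) * plaqCentre f) ≤ M := hmax hf
  rw [abs_le] at h1
  have h3 : u n f / N n ≤ M / 2 := by linarith
  have := hN n
  rw [div_le_iff₀ this] at h3
  linarith

/-! ### The contradiction near a boundary point -/

/-- **Negativity of the limit near a boundary point is contradictory.**
[cite: ChelkakSmirnov2012Ising, proof of Thm. 6.1 and Remark 6.3] -/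
theorem false_of_neg_near_frontier {Ω G Bad W : Set ℂ} (hΩ : IsOpen Ω) (hΩc : IsPathConnected Ω) {ζ : ℂ} (hζ : ζ ∈ frontier Ω)
    {ρ : ℝ} (hext : ∃ e, dist e ζ < ρ / 10 ∧ e ∉ closure Ω) (hG : ball ζ ρ ⊆ G)
    (hWo : IsOpen W) (hWc : IsPathConnected W) (hWb : Bornology.IsBounded W) (hBad : Bad ⊆ W) (hWΩ : closure W ⊆ Ω)
    (hWfar : ∀ x ∈ closure W, ρ ≤ dist x ζ) (hWne : W.Nonempty)
    {hlim : ℂ → ℝ} (hcont : ContinuousOn hlim (Ω ∩ ball ζ ρ)) (hneg : ∀ z ∈ Ω ∩ ball ζ ρ, hlim z < 0)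
    (δ : ℕ → ℝ) (hδ : ∀ n, 0 < δ n) (hδ0 : Tendsto δ atTop (𝓝 0))
    (Λ : ℕ → Finset (Site 2)) (hΛ : ∀ n, HoleFree (↑(Λ n) : Set (Site 2)))
    (u : ℕ → Site 2 → ℝ) (N : ℕ → ℝ) (hN : ∀ n, 0 < N n) {Mu : ℝ} (hMu : 0 ≤ Mu)
    (hSub : ∀ n, ∀ f : Site 2, (∃ i : Fin 4, f + cornerOff i ∈ Λ n) → ((δ n : ℝ) : ℂ) * plaqCentre f ∉ W →
      0 ≤ kcModLaplacian (Λ n) (fun _ => 0) (u n) f)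
    (hU0 : ∀ n, ∀ f : Site 2, (∃ i : Fin 4, f + cornerOff i ∉ Λ n) → ((δ n : ℝ) : ℂ) * plaqCentre f ∈ G → 0 ≤ u n f)
    (hUbd : ∀ n, ∀ f : Site 2, ((δ n : ℝ) : ℂ) * plaqCentre f ∈ G → u n f ≤ Mu * N n)
    (hconv : ∀ K : Set ℂ, IsCompact K → K ⊆ Ω ∩ ball ζ ρ → ∀ ε, 0 < ε → ∀ᶠ n in atTop, ∀ f : Site 2,
      ((δ n : ℝ) : ℂ) * plaqCentre f ∈ K → |u n f / N n - hlim (((δ n : ℝ) : ℂ) * plaqCentre f)| ≤ ε)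
    (hbulk : ∀ K : Set ℂ, IsCompact K → K ⊆ Ω → ∀ᶠ n in atTop, ∀ v : Site 2, ((δ n : ℝ) : ℂ) * toComplex v ∈ K → v ∈ Λ n)
    (hvis : ∀ ε : ℝ, 0 < ε → ∀ᶠ n in atTop, ∀ p ∈ frontier Ω, ∃ b : Site 2, b ∉ Λ n ∧ dist (((δ n : ℝ) : ℂ) * toComplex b) p ≤ ε) :
    False := by
  obtain ⟨cfg, hW, hKmid, hKflat⟩ := exists_config (Bad := Bad) hΩ hΩc hζ hext hG hWo hWc hWb hBad hWΩ hWfar hWne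
  -- the eventual signs
  have hUmid : ∀ μ : ℝ, 0 < μ → ∀ᶠ n in atTop, ∀ f : Site 2, ((δ n : ℝ) : ℂ) * plaqCentre f ∈ cfg.Kmid μ → u n f ≤ 0 := by
    intro μ hμ
    obtain ⟨η, hη, hev⟩ := eventually_le_of_conv (cfg.isCompact_Kmid μ) (hKmid μ hμ) hcont hneg δ u N hN
      (hconv _ (cfg.isCompact_Kmid μ) (hKmid μ hμ))
    refine hev.mono fun n hn f hf => (hn f hf).trans ?_
    have := hN n
    nlinarith
  obtain ⟨η₀, hη₀, hUflat⟩ := eventually_le_of_conv cfg.isCompact_Kflat hKflat hcont hneg δ u N hN (hconv _ cfg.isCompact_Kflat hKflat)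
  refine cfg.false_of_limit δ hδ hδ0 Λ hΛ u N hN hMu hη₀ (fun n f hf hfW => hSub n f hf (by rwa [hW] at hfW)) hU0 hUbd hUmid hUflat hbulk hvis

/-! ### The exceptional region about two interior points -/

/-- The open thickening of the range of a path is path-connected. [folklore] -/
theorem isPathConnected_thickening_range {x y : ℂ} (γ : Path x y) {ε : ℝ} (hε : 0 < ε) : IsPathConnected (thickening ε (range γ)) := by
  have hsub : range γ ⊆ thickening ε (range γ) := self_subset_thickening hε _
  refine ⟨x, hsub ⟨0, γ.source⟩, fun z hz => ?_⟩
  obtain ⟨w, hw, hzw⟩ := mem_thickening_iff.1 hz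
  -- `z` joins `w` by the straight segment inside `ball w ε ⊆ thickening`, and `w` joins `x` along `γ`
  have h1 : JoinedIn (thickening ε (range γ)) z w := by
    have hzb : z ∈ ball w ε := mem_ball.2 hzw
    have hsub' : ball w ε ⊆ thickening ε (range γ) := fun y hy => mem_thickening_iff.2 ⟨w, hw, mem_ball.1 hy⟩
    exact (((convex_ball w ε).isPathConnected ⟨w, mem_ball_self hε⟩).joinedIn z hzb w (mem_ball_self hε)).mono hsub'
  have h2 : JoinedIn (thickening ε (range γ)) w x := by
    obtain ⟨s, rfl⟩ := hw
    have : JoinedIn (range γ) (γ s) x := by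
      refine ⟨(γ.truncateOfLE (show (0 : ℝ) ≤ s from s.2.1)).symm.cast (by simp) (by simp), fun t => ?_⟩
      rw [Path.cast_coe, Path.symm_apply]
      exact Path.truncate_range _ (mem_range_self _)
    exact this.mono hsub
  exact (h1.trans h2).symm

/-- **The exceptional region.** For interior points `a, b` of an open path-connected set `Ω` with
`closedBall a r ∪ closedBall b r ⊆ Ω`, there is an open, path-connected, bounded `W ⊇ ball a r ∪ ball b r`
with `closure W ⊆ Ω`. [folklore] -/
theorem exists_exceptional_region {Ω : Set ℂ} (hΩ : IsOpen Ω) (hΩc : IsPathConnected Ω) {a b : ℂ} {r : ℝ} (hr : 0 < r)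
    (ha : closedBall a r ⊆ Ω) (hb : closedBall b r ⊆ Ω) :
    ∃ W : Set ℂ, IsOpen W ∧ IsPathConnected W ∧ Bornology.IsBounded W ∧ ball a r ∪ ball b r ⊆ W ∧ closure W ⊆ Ω ∧ W.Nonempty := by
  have haΩ : a ∈ Ω := ha (mem_closedBall_self hr.le)
  have hbΩ : b ∈ Ω := hb (mem_closedBall_self hr.le)
  set γ : Path a b := (hΩc.joinedIn a haΩ b hbΩ).somePath with hγ
  have hγΩ : range γ ⊆ Ω := by rintro _ ⟨t, rfl⟩; exact (hΩc.joinedIn a haΩ b hbΩ).somePath_mem t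
  obtain ⟨ε, hε, hεsub⟩ := (isCompact_range γ.continuous).exists_cthickening_subset_open hΩ hγΩ
  refine ⟨thickening ε (range γ) ∪ ball a r ∪ ball b r, (isOpen_thickening.union isOpen_ball).union isOpen_ball, ?_, ?_, ?_, ?_, ⟨a, ?_⟩⟩
  · have h1 := isPathConnected_thickening_range γ hε
    have haT : a ∈ thickening ε (range γ) := self_subset_thickening hε _ ⟨0, γ.source⟩
    have hbT : b ∈ thickening ε (range γ) := self_subset_thickening hε _ ⟨1, γ.target⟩
    refine IsPathConnected.union (IsPathConnected.union h1 ((convex_ball a r).isPathConnected ⟨a, mem_ball_self hr⟩) ⟨a, haT, mem_ball_self hr⟩)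
      ((convex_ball b r).isPathConnected ⟨b, mem_ball_self hr⟩) ⟨b, Or.inl hbT, mem_ball_self hr⟩
  · exact ((isCompact_range γ.continuous).isBounded.thickening.union isBounded_ball).union isBounded_ball
  · intro x hx; rcases hx with hx | hx
    · exact Or.inl (Or.inr hx)
    · exact Or.inr hx
  · rw [closure_union, closure_union]
    refine union_subset (union_subset ?_ ?_) ?_
    · exact (closure_thickening_subset_cthickening _ _).trans hεsub
    · exact closure_ball_subset_closedBall.trans ha
    · exact closure_ball_subset_closedBall.trans hb
  · exact Or.inl (Or.inr (mem_ball_self hr))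

/-! ### Jordan domains -/

/-- **Negativity of the limit near a boundary point of a Jordan domain is contradictory**, the
exceptional set being two balls about interior points (exterior points near the boundary come from
the Jordan curve theorem). [cite: ChelkakSmirnov2012Ising, proof of Thm. 6.1 and Remark 6.3] -/
theorem JordanDomain.false_of_neg_near_frontier (D : Literature.Probability.RandomPlanarGeometry.JordanDomain)
    {ζ : ℂ} (hζ : ζ ∈ frontier D.carrier) {ρ₀ : ℝ} (hρ₀ : 0 < ρ₀) {G : Set ℂ} (hG : ball ζ ρ₀ ⊆ G)
    {a b : ℂ} {r : ℝ} (hr : 0 < r) (ha : closedBall a r ⊆ D.carrier) (hb : closedBall b r ⊆ D.carrier)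
    {hlim : ℂ → ℝ} (hcont : ContinuousOn hlim (D.carrier ∩ ball ζ ρ₀)) (hneg : ∀ z ∈ D.carrier ∩ ball ζ ρ₀, hlim z < 0)
    (δ : ℕ → ℝ) (hδ : ∀ n, 0 < δ n) (hδ0 : Tendsto δ atTop (𝓝 0))
    (Λ : ℕ → Finset (Site 2)) (hΛ : ∀ n, HoleFree (↑(Λ n) : Set (Site 2)))
    (u : ℕ → Site 2 → ℝ) (N : ℕ → ℝ) (hN : ∀ n, 0 < N n) {Mu : ℝ} (hMu : 0 ≤ Mu)
    (hSub : ∀ n, ∀ f : Site 2, (∃ i : Fin 4, f + cornerOff i ∈ Λ n) → ((δ n : ℝ) : ℂ) * plaqCentre f ∉ ball a r ∪ ball b r →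
      0 ≤ kcModLaplacian (Λ n) (fun _ => 0) (u n) f)
    (hU0 : ∀ n, ∀ f : Site 2, (∃ i : Fin 4, f + cornerOff i ∉ Λ n) → ((δ n : ℝ) : ℂ) * plaqCentre f ∈ G → 0 ≤ u n f)
    (hUbd : ∀ n, ∀ f : Site 2, ((δ n : ℝ) : ℂ) * plaqCentre f ∈ G → u n f ≤ Mu * N n)
    (hconv : ∀ K : Set ℂ, IsCompact K → K ⊆ D.carrier ∩ ball ζ ρ₀ → ∀ ε, 0 < ε → ∀ᶠ n in atTop, ∀ f : Site 2,
      ((δ n : ℝ) : ℂ) * plaqCentre f ∈ K → |u n f / N n - hlim (((δ n : ℝ) : ℂ) * plaqCentre f)| ≤ ε)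
    (hbulk : ∀ K : Set ℂ, IsCompact K → K ⊆ D.carrier → ∀ᶠ n in atTop, ∀ v : Site 2, ((δ n : ℝ) : ℂ) * toComplex v ∈ K → v ∈ Λ n)
    (hvis : ∀ ε : ℝ, 0 < ε → ∀ᶠ n in atTop, ∀ p ∈ frontier D.carrier, ∃ b : Site 2, b ∉ Λ n ∧ dist (((δ n : ℝ) : ℂ) * toComplex b) p ≤ ε) :
    False := by
  set Ω := D.carrier with hΩdef
  have hΩ : IsOpen Ω := D.isOpen
  have hΩc : IsPathConnected Ω := (hΩ.isConnected_iff_isPathConnected).1 D.isConnected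
  -- the exceptional region
  obtain ⟨W, hWo, hWc, hWb, hballs, hWΩ, hWne⟩ := exists_exceptional_region hΩ hΩc hr ha hb
  have hζΩ : ζ ∉ Ω := fun h => hζ.2 (by rwa [hΩ.interior_eq])
  have hζW : ζ ∉ closure W := fun h => hζΩ (hWΩ h)
  have hWcl : IsClosed (closure W) := isClosed_closure
  have hWne' : (closure W).Nonempty := hWne.mono subset_closure
  have hd : 0 < infDist ζ (closure W) := (hWcl.notMem_iff_infDist_pos hWne').1 hζW
  set ρ : ℝ := min ρ₀ (infDist ζ (closure W)) with hρdef
  have hρ : 0 < ρ := lt_min hρ₀ hd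
  have hρle : ρ ≤ ρ₀ := min_le_left _ _
  have hWfar : ∀ x ∈ closure W, ρ ≤ dist x ζ := fun x hx => by
    rw [dist_comm]; exact (min_le_right _ _).trans (infDist_le_dist_of_mem hx)
  -- an exterior point near `ζ` (Jordan curve theorem)
  have hext : ∃ e, dist e ζ < ρ / 10 ∧ e ∉ closure Ω := by
    have := D.frontier_subset_closure_exterior Literature.Topology.PlaneTopology.JordanCurveTheorem_holds hζ
    obtain ⟨e, he, hed⟩ := Metric.mem_closure_iff.1 this (ρ / 10) (by positivity)
    exact ⟨e, by rw [dist_comm]; exact hed, he⟩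
  have hsub : Ω ∩ ball ζ ρ ⊆ Ω ∩ ball ζ ρ₀ := fun x hx => ⟨hx.1, ball_subset_ball hρle hx.2⟩
  refine Literature.Probability.LatticeModels.false_of_neg_near_frontier (Bad := ball a r ∪ ball b r) hΩ hΩc hζ hext ((ball_subset_ball hρle).trans hG) hWo hWc hWb hballs hWΩ hWfar hWne
    (hcont.mono hsub) (fun z hz => hneg z (hsub hz)) δ hδ hδ0 Λ hΛ u N hN hMu (fun n f hf hfW => hSub n f hf fun h => hfW (hballs h)) hU0 hUbd
    (fun K hK hKs => hconv K hK (hKs.trans hsub)) hbulk hvis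

end Literature.Probability.LatticeModels
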